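import Summits.ABC.StewartYu.ArchG3Par
import HarnessLib

/-!
# The ARCHIMEDEAN Gen-3 record of reference `ArchG3Rec` (plan R32: ONE STAGE, `𝔑` threaded; WP-L.A P-A8, crux r2 `ArchCoreRat`)

Support file (one structure, plain definitions, elementary theorems; no named facts). Cell `abc-stewartyu`, seat p1
(record owner). This is the record the r2 line (`Lines/arch-g3-frame.lean`: `stub_startArch` / `stub_levelsArch` /
`stub_endArch`) is typed against (R32 (b)); it supersedes `ArchG3Par` (v1 + v2 append), whose structure carries the
vestigial field `hNW : log N ≤ W` and therefore only serves the `N = 1` instance. Numerics OF RECORD (R26(d)) before this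
file: HOME/p1/num/g10/arch_table_v3.md (kit v3b, jobs j285688/j285691; local n = 2,3,4: 0 failures / 1008 cases, incl. the
adversarial rows of lit 17:06:59Z / R32: `B = 1`, `A = (1,…,1,A_max)`, `N ≍ (2/log 2)ⁿΩ`).

DESIGN (print = [Nesterenko2003] §3.5 (3.23)/(3.25), §4 (4.3), §5.2 (5.6)/(5.12); cell lit FINDING #4; plan R32):
* data: the REDUCED pivot-weighted datum's weights `1 ≤ A j ≤ A_max` (so `A_max ≤ Ω`), text-`W ≥ 1` (`W ≥ log(eB)`), and
  the saturation index `1 ≤ N = [𝔑 : ℤⁿ] ≤ (2/log 2)ⁿ·Ω` — NO `log N ≤ W`;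
* the FREE gain `G = 8(n+1)` (radius ratio `e^G`), `K = ⌈n·e^{G+2}⌉₊ + 1` pigeonhole slab classes, depth
  `Ŝ = n + 24 + ⌊log₂(K·N)⌋` (`2^{n+23}KN < 2^Ŝ ≤ 2^{n+24}KN`), loads `yload_K ≤ yload` — all as in `ArchG3Par`
  (the `n`-only closed forms `G, K, SdK, yloadK` are REUSED from there);
* the per-derivative unit **`WN = W + log N`** (`log(eBN) + O(1)`; Taylor jets normalised by `e^{WN}`, one-off factor
  charged to the degree budget; NO `log L`), ranges `X = max(⌈64(n+1)·WN/G⌉, ⌈(3/2)(n+1)L/(C_bⁿΩK)⌉, 64(n+1))`;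
* the degrees BALANCED by `W/WN`: **`L = max(⌈24 C_bⁿ Ω K·yload_K·W/(G·WN)⌉, 2^{n+25}, ⌈2A_max/N⌉₊ + 1, 4(Ŝ+2))`** so
  that `X·L ≍ Ω·W` — N-free and log-free (R32 STANDING RULE: the only logarithm multiplying an `Ω`-sized quantity is
  text-`W`); the `A_max` floor is the harmless `σⱼ ≥ 1/N` floor of the coset-average `𝔑`-count (R32 (b));
* the CAPPED level schedule of print (4.3): `T s = max 1 (8L/2^s)` (order drop ≥ 1) and
  **`Xs s = min(⌊2^{s−1}X⌋ + 1, ⌊4·X·L/(T s + 1)⌋ + 1)`** — `Xs·(T+1) ≍ 4XL` at EVERY level, no doubling past the floor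
  (the deepest-level interpolation constant is then `∝ X·L`, N-free: kit v3 found the doubling schedule leaks
  `K·N·X ∝ Ω·(W + log N)` into the headline); END range `X_fin = ⌊2ⁿ·Xs Ŝ/(n+1)⌋ ≥ 2^{2n+22}X/(n+1)` (print (5.12));
* `M = 16(n+1)L`, `L₀ = ⌈6X·C_bⁿΩK/N⌉` (Siegel over `𝔑`, Blichfeldt's factor `N`), `H = max 1 ⌊G X/(64(n+1))⌋`,
  `R/Mord` tail-sum orders, END letters `D₀ = L₀ + 1`, `D j = ⌊K·N·L/(2^Ŝ A j)⌋ + 1` (N-free: `≤ L/(2^{n+23}A j) + 1`),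
  `S₀ = M/(n+2)⁴`, the unit `Z = G·X·L`, `zeros s ν = G·(2^{ν+1}Xs s)·(T s + 1)`.
HEADLINE TARGET (text, R32): `U ≤ C(n)·Ω·W`. This file: structure, closed forms, depth sandwich, scale floors; the
schedule laws / zeros gain / END facts are `ArchG3RecA`.

## References
* [Nesterenko2003] Yu. V. Nesterenko, *Linear forms in logarithms of rational numbers*, LNM 1819 (2003) — §3.4 (3.16),
  §3.5 (3.22)–(3.25), §4 (4.3)–(4.5), §4.2 (4.20)–(4.25), §5.2 (5.6), (5.12).
* [Matveev2000] E. M. Matveev, Izv. Math. 64 (2000) — §3 (the slab).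
-/

noncomputable section

open Finset Real

namespace Summit.ABC.StewartYu

/-- **The data of the archimedean Gen-3 record of reference** (one-stage, `𝔑`-threaded): `n ≥ 1` weights
`1 ≤ A j ≤ A_max ≤ Ω`, text-`W ≥ 1` (`W ≥ log(eB)`), saturation index `1 ≤ N ≤ (2/log 2)ⁿ·Ω`.
[cite: Nesterenko2003, §2 (2.3), §3.4 (3.16)] -/
structure ArchG3Rec (n : ℕ) where
  /-- weights of the generators (`≥ max(1, h(αⱼ))`) -/
  A : Fin n → ℝ
  /-- a common bound of the weights (enters only through the harmless box floor) -/
  Amax : ℝ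
  /-- text-`W ≥ log(eB)` of the reduced pivot-weighted datum -/
  W : ℝ
  /-- the saturation index `N = [𝔑 : ℤⁿ]` -/
  N : ℕ
  hn : 1 ≤ n
  hA : ∀ j, 1 ≤ A j
  hAmax : ∀ j, A j ≤ Amax
  hW : 1 ≤ W
  hN : 1 ≤ N
  hNΩ : (N : ℝ) ≤ (2 / Real.log 2) ^ n * ∏ j, A j
  /-- the bound is attained up to `Ω` (instantiate `Amax := A k₀`, the pivot = maximal weight) -/
  hAmaxΩ : Amax ≤ ∏ j, A j

namespace ArchG3Rec

open PadicG3Par (cG cM Cb cG_pos Cb_pos)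
open ArchG3Par (G K SdK yloadK G_eq eight_le_G G_pos one_le_K K_pos two_G_le_yloadK yloadK_pos)

variable {n : ℕ} (P : ArchG3Rec n)

/-! ### The closed forms -/

/-- `Ω = ∏ A j`. [cite: Nesterenko2003, (2.3)] -/
def Ω : ℝ := ∏ j, P.A j

/-- the per-derivative cost unit `WN = W + log N` (`log(eBN) + O(1)`; NO `log L`).
[cite: Nesterenko2003, §3.5 (3.23) and §4.2 (4.20)–(4.23)] -/
def WN : ℝ := P.W + Real.log P.N

/-- the depth `Ŝ = n + 24 + ⌊log₂(K·N)⌋`. [cite: Nesterenko2003, §3.5 (S = n + 24 + [log₂ N])] -/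
def Sd : ℕ := n + 24 + Nat.log 2 (K n * P.N)

/-- the true `Y₀`-load `yload = 2G + (Ŝ + n + 1) log 2 + log(n+1) + 8`. [folklore] -/
def yload : ℝ := 2 * G n + (P.Sd + n + 1) * Real.log 2 + Real.log (n + 1) + 8

/-- the BALANCED multiplicity/box scale
`L = max(⌈24 C_bⁿ Ω K·yload_K·W/(G·WN)⌉, 2^{n+25}, ⌈2A_max/N⌉₊ + 1, 4(Ŝ+2))` (`X·L ≍ Ω·W`).
[cite: Nesterenko2003, §3.5 (L = 0.8λ^{n+3}(n+1)^{5/2}(log eB/log eBN)Ω)] -/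
def L : ℕ :=
  max (max ⌈24 * Cb ^ n * P.Ω * K n * yloadK n * P.W / (G n * P.WN)⌉₊ (2 ^ (n + 25)))
    (max (⌈2 * P.Amax / P.N⌉₊ + 1) (4 * (P.Sd + 2)))

/-- the total multiplicity `M = 16(n+1)L`. [cite: Nesterenko2003, Prop 3.9] -/
def M : ℕ := 16 * (n + 1) * P.L

/-- the order drop `T s = max 1 (8L/2^s)` (floored at `1`). [cite: Nesterenko2003, (4.3)] -/
def T (s : ℕ) : ℕ := max 1 (8 * P.L / 2 ^ s)

/-- the number of points `X = max(⌈64(n+1)·WN/G⌉, ⌈(3/2)(n+1)L/(C_bⁿΩK)⌉, 64(n+1))`. [cite: Nesterenko2003, Prop 3.9 (3.25)] -/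
def X : ℕ :=
  max (max ⌈64 * (n + 1) * P.WN / G n⌉₊ ⌈(3 / 2) * (n + 1) * P.L / (Cb ^ n * P.Ω * K n)⌉₊) (64 * (n + 1))

/-- the CAPPED range at level `s`: `Xs s = min(⌊2^{s−1}X⌋ + 1, ⌊4XL/(T s + 1)⌋ + 1)`. [cite: Nesterenko2003, (4.3)] -/
def Xs (s : ℕ) : ℕ :=
  min (⌊(2 : ℝ) ^ s * G n * P.X / (16 * (n + 1))⌋₊ + 1) (4 * P.X * P.L / (P.T s + 1) + 1)

/-- the `Y₀`-degree `L₀ = ⌈6 X C_bⁿ Ω K/N⌉` (Siegel over `𝔑`). [cite: Nesterenko2003, (3.23)] -/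
def L₀ : ℕ := ⌈6 * P.X * Cb ^ n * P.Ω * K n / P.N⌉₊

/-- the Feldman block `H = max 1 ⌊G X/(64(n+1))⌋`. [cite: Nesterenko2003, (3.23)] -/
def H : ℕ := max 1 ⌊G n * P.X / (64 * (n + 1))⌋₊

/-- remaining drops `R s = Σ_{s' ∈ [s, Ŝ]} T s'`. [cite: Nesterenko2003, (4.5)] -/
def R (s : ℕ) : ℕ := ∑ s' ∈ Finset.Icc s P.Sd, P.T s'

/-- the order at stage `(s, ν)`: `Mord s ν = M/(n+2)³ + (n+1)·R(s+1) + (n+1−ν)·T s`. [cite: Nesterenko2003, (4.5)] -/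
def Mord (s ν : ℕ) : ℕ := P.M / (n + 2) ^ 3 + (n + 1) * P.R (s + 1) + (n + 1 - ν) * P.T s

/-- `D₀ = L₀ + 1`. [cite: Nesterenko2003, §5.2] -/
def D₀ : ℕ := P.L₀ + 1

/-- the END degrees `D j = ⌊K·N·L/(2^Ŝ A j)⌋ + 1` (`≤ L/(2^{n+23}A j) + 1`, N-free). [cite: Nesterenko2003, (5.5)] -/
def D (j : Fin n) : ℕ := ⌊(K n : ℝ) * P.N * P.L / (2 ^ P.Sd * P.A j)⌋₊ + 1

/-- the END range `X_fin = ⌊2ⁿ·Xs Ŝ/(n+1)⌋`. [cite: Nesterenko2003, §5.2 (5.12)] -/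
def Xfin : ℕ := 2 ^ n * P.Xs P.Sd / (n + 1)

/-- `S₀ = M/(n+2)⁴`. [cite: Nesterenko2003, (5.8)] -/
def S₀ : ℕ := P.M / (n + 2) ^ 4

/-- the unit `Z = G·(X·L)`. [folklore] -/
def Z : ℝ := G n * (P.X * P.L)

/-- the zeros gain at stage `(s, ν)`: `G·(2^{ν+1}Xs s)·(T s + 1)`. [cite: Nesterenko2003, (4.25)] -/
def zeros (s ν : ℕ) : ℝ := G n * (2 ^ (ν + 1) * P.Xs s) * (P.T s + 1)

/-! ### Positivity and the data floors -/

/-- the weights: `0 < A j`, `1 ≤ A j ≤ A_max`. [folklore] -/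
theorem A_facts (j : Fin n) : 0 < P.A j ∧ 1 ≤ P.A j ∧ P.A j ≤ P.Amax :=
  ⟨lt_of_lt_of_le one_pos (P.hA j), P.hA j, P.hAmax j⟩

/-- `Ω`: `0 < Ω`, `1 ≤ Ω`, `A_max ≤ Ω`, `1 ≤ A_max`. [folklore] -/
theorem Ω_facts : 0 < P.Ω ∧ 1 ≤ P.Ω ∧ P.Amax ≤ P.Ω ∧ 1 ≤ P.Amax := by
  have h1 : 1 ≤ P.Ω := Finset.one_le_prod fun j _ => P.hA j
  exact ⟨lt_of_lt_of_le one_pos h1, h1, P.hAmaxΩ, (P.hA ⟨0, P.hn⟩).trans (P.hAmax _)⟩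

/-- `N`: `0 < N`, `1 ≤ N` (real) and `0 ≤ log N`. [folklore] -/
theorem N_facts : (0 : ℝ) < P.N ∧ (1 : ℝ) ≤ P.N ∧ 0 ≤ Real.log P.N := by
  have h : (1 : ℝ) ≤ P.N := by exact_mod_cast P.hN
  exact ⟨lt_of_lt_of_le one_pos h, h, Real.log_nonneg h⟩

/-- the unit: `1 ≤ WN`, `W ≤ WN`, `log N ≤ WN`, `0 < WN`. [folklore] -/
theorem WN_bounds : 1 ≤ P.WN ∧ P.W ≤ P.WN ∧ Real.log P.N ≤ P.WN ∧ 0 < P.WN := by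
  have h := P.N_facts.2.2
  have hW := P.hW
  unfold WN
  exact ⟨by linarith, by linarith, by linarith, by linarith⟩

/-- `16 ≤ G` as `n ≥ 1`. [folklore] -/
theorem sixteen_le_G' (P : ArchG3Rec n) : (16 : ℝ) ≤ G n ∧ (1 : ℝ) ≤ n := by
  have hn : (1 : ℝ) ≤ n := by exact_mod_cast P.hn
  rw [G_eq]; exact ⟨by linarith, hn⟩

/-- `1 ≤ K·N` (and `K·N ≠ 0`). [folklore] -/
theorem KN_facts : 1 ≤ K n * P.N ∧ K n * P.N ≠ 0 := by
  have h : 1 ≤ K n * P.N := Nat.mul_pos (one_le_K n) P.hN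
  exact ⟨h, by omega⟩

/-! ### The depth -/

/-- the depth sandwich: `2^{n+23}·K·N < 2^Ŝ ≤ 2^{n+24}·K·N`. [cite: Nesterenko2003, (5.6)] -/
theorem Sd_sandwich : 2 ^ (n + 23) * (K n * P.N) < 2 ^ P.Sd ∧ 2 ^ P.Sd ≤ 2 ^ (n + 24) * (K n * P.N) := by
  have e : 2 ^ P.Sd = 2 ^ (n + 24) * 2 ^ Nat.log 2 (K n * P.N) := by unfold Sd; rw [← pow_add]
  refine ⟨?_, ?_⟩
  · have h := Nat.lt_pow_succ_log_self (b := 2) (by norm_num) (K n * P.N)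
    rw [e]
    calc 2 ^ (n + 23) * (K n * P.N) < 2 ^ (n + 23) * 2 ^ (Nat.log 2 (K n * P.N) + 1) :=
          Nat.mul_lt_mul_of_pos_left h (Nat.two_pow_pos _)
      _ = 2 ^ (n + 24) * 2 ^ Nat.log 2 (K n * P.N) := by ring
  · have h : 2 ^ Nat.log 2 (K n * P.N) ≤ K n * P.N := Nat.pow_log_le_self 2 P.KN_facts.2
    rw [e]; exact Nat.mul_le_mul_left _ h

/-- depth bounds: `ŜK ≤ Ŝ ≤ ŜK + ⌊log₂ N⌋ + 1` and `n + 24 ≤ Ŝ`. [folklore] -/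
theorem Sd_bounds : SdK n ≤ P.Sd ∧ P.Sd ≤ SdK n + Nat.log 2 P.N + 1 ∧ n + 24 ≤ P.Sd := by
  refine ⟨?_, ?_, by unfold Sd; omega⟩
  · unfold SdK Sd
    have : Nat.log 2 (K n) ≤ Nat.log 2 (K n * P.N) := Nat.log_mono_right (Nat.le_mul_of_pos_right _ P.hN)
    omega
  · unfold SdK Sd
    have h1 : K n < 2 ^ (Nat.log 2 (K n) + 1) := Nat.lt_pow_succ_log_self one_lt_two _
    have h2 : P.N < 2 ^ (Nat.log 2 P.N + 1) := Nat.lt_pow_succ_log_self one_lt_two _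
    have h3 : K n * P.N < 2 ^ (Nat.log 2 (K n) + Nat.log 2 P.N + 1 + 1) := by
      calc K n * P.N ≤ K n * 2 ^ (Nat.log 2 P.N + 1) := Nat.mul_le_mul_left _ h2.le
        _ < 2 ^ (Nat.log 2 (K n) + 1) * 2 ^ (Nat.log 2 P.N + 1) :=
            Nat.mul_lt_mul_of_pos_right h1 (Nat.two_pow_pos _)
        _ = 2 ^ (Nat.log 2 (K n) + Nat.log 2 P.N + 1 + 1) := by rw [← pow_add]; ring_nf
    have := Nat.lt_succ_iff.1 (Nat.log_lt_of_lt_pow' (by omega) h3)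
    omega

/-- `⌊log₂ N⌋ + 1 ≤ N`, hence `Ŝ ≤ ŜK + N` (the extra depth is at most `N ≤ (2/log 2)ⁿΩ`). [folklore] -/
theorem Sd_le_SdK_add_N : Nat.log 2 P.N + 1 ≤ P.N ∧ P.Sd ≤ SdK n + P.N := by
  have h1 : Nat.log 2 P.N + 1 ≤ P.N :=
    Nat.succ_le_of_lt (Nat.log_lt_of_lt_pow' (by have := P.hN; omega) Nat.lt_two_pow_self)
  exact ⟨h1, by have := P.Sd_bounds.2.1; omega⟩

/-- loads: `yload_K ≤ yload`, `0 < yload_K`, `2G ≤ yload_K`. [folklore] -/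
theorem yload_facts : yloadK n ≤ P.yload ∧ 0 < yloadK n ∧ 2 * G n ≤ yloadK n := by
  refine ⟨?_, yloadK_pos n, two_G_le_yloadK n⟩
  unfold yloadK yload
  have h : (SdK n : ℝ) ≤ P.Sd := by exact_mod_cast P.Sd_bounds.1
  have hl : 0 < Real.log 2 := Real.log_pos one_lt_two
  nlinarith

/-! ### The scale `L` and its floors -/

/-- the balanced Siegel term: `24 C_bⁿ Ω K·yload_K·W/(G·WN) ≤ L`. [folklore] -/
theorem main_le_L : 24 * Cb ^ n * P.Ω * K n * yloadK n * P.W / (G n * P.WN) ≤ P.L := by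
  have h : (⌈24 * Cb ^ n * P.Ω * K n * yloadK n * P.W / (G n * P.WN)⌉₊ : ℝ) ≤ P.L := by
    unfold L; exact_mod_cast le_trans (le_max_left _ _) (le_max_left _ _)
  exact (Nat.le_ceil _).trans h

/-- the floors of `L`: `2^{n+25} ≤ L`, `⌈2A_max/N⌉₊ + 1 ≤ L`, `4(Ŝ+2) ≤ L`. [folklore] -/
theorem L_floors : 2 ^ (n + 25) ≤ P.L ∧ ⌈2 * P.Amax / P.N⌉₊ + 1 ≤ P.L ∧ 4 * (P.Sd + 2) ≤ P.L := by
  unfold L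
  exact ⟨le_trans (le_max_right _ _) (le_max_left _ _), le_trans (le_max_left _ _) (le_max_right _ _),
    le_trans (le_max_right _ _) (le_max_right _ _)⟩

/-- `L` in `ℝ`: `1 ≤ L`, `0 < L`, `2^{n+25} ≤ L`, and the harmless box floor `2A_max/N < L` (so `N·L/(2A j) > 1`:
the `σⱼ ≥ 1/N` floor of the coset-average `𝔑`-count). [folklore] -/
theorem L_real : (1 : ℝ) ≤ P.L ∧ (0 : ℝ) < P.L ∧ (2 : ℝ) ^ (n + 25) ≤ P.L ∧ 2 * P.Amax / P.N < P.L := by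
  obtain ⟨h25, hA, -⟩ := P.L_floors
  have h1 : 1 ≤ P.L := le_trans Nat.one_le_two_pow h25
  have h1' : (1 : ℝ) ≤ P.L := by exact_mod_cast h1
  have h25' : (2 : ℝ) ^ (n + 25) ≤ P.L := by exact_mod_cast h25
  have hA' : ((⌈2 * P.Amax / P.N⌉₊ + 1 : ℕ) : ℝ) ≤ P.L := by exact_mod_cast hA
  push_cast at hA'
  exact ⟨h1', lt_of_lt_of_le one_pos h1', h25', by linarith [Nat.le_ceil (2 * P.Amax / P.N)]⟩

/-- **the unbalanced core is recovered up to the unit ratio**: `24 C_bⁿ Ω K·(W/WN) ≤ L` and, multiplying back,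
`24 C_bⁿ Ω K·yload_K·W ≤ G·WN·L` (this is the form the budget lines use: `X ≍ WN` supplies the `WN`).
[cite: Nesterenko2003, §3.5 (3.23)] -/
theorem core_le_L : 24 * Cb ^ n * P.Ω * K n * yloadK n * P.W ≤ G n * P.WN * P.L ∧
    24 * Cb ^ n * P.Ω * K n * (P.W / P.WN) ≤ P.L := by
  have h := P.main_le_L
  have hG := G_pos n
  have hWN := P.WN_bounds.2.2.2
  have hGW : 0 < G n * P.WN := mul_pos hG hWN
  rw [div_le_iff₀ hGW] at h
  refine ⟨by linarith, ?_⟩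
  have hy : 2 * G n ≤ yloadK n := two_G_le_yloadK n
  have hc : 0 ≤ 24 * Cb ^ n * P.Ω * K n * P.W := by
    have := P.Ω_facts.1; have := K_pos n; have := Cb_pos; have := P.hW; positivity
  have h2 : 24 * Cb ^ n * P.Ω * K n * P.W * (2 * G n) ≤ G n * P.WN * P.L * 1 := by nlinarith
  rw [mul_div_assoc', div_le_iff₀ hWN]
  nlinarith

/-! ### The ranges -/

/-- the floors of `X`: `64(n+1) ≤ X` (so `128 ≤ X`), the unit term `64(n+1)·WN/G ≤ X`, the END term
`(3/2)(n+1)L/(C_bⁿΩK) ≤ X`. [cite: Nesterenko2003, Prop 3.9 (3.25)] -/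
theorem X_floors : 64 * (n + 1) ≤ P.X ∧ (128 : ℝ) ≤ P.X ∧ 64 * (n + 1) * P.WN / G n ≤ P.X ∧
    (3 / 2) * (n + 1) * P.L / (Cb ^ n * P.Ω * K n) ≤ P.X := by
  have h64 : 64 * (n + 1) ≤ P.X := by unfold X; exact le_max_right _ _
  have h128 : (128 : ℝ) ≤ P.X := by
    have h : 64 * (1 + 1) ≤ 64 * (n + 1) := Nat.mul_le_mul_left _ (by have := P.hn; omega)
    exact_mod_cast le_trans (le_trans (by norm_num) h) h64
  have hu : (⌈64 * (n + 1) * P.WN / G n⌉₊ : ℝ) ≤ P.X := by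
    unfold X; exact_mod_cast le_trans (le_max_left _ _) (le_max_left _ _)
  have he : (⌈(3 / 2) * (n + 1) * P.L / (Cb ^ n * P.Ω * K n)⌉₊ : ℝ) ≤ P.X := by
    unfold X; exact_mod_cast le_trans (le_max_right _ _) (le_max_left _ _)
  exact ⟨h64, h128, (Nat.le_ceil _).trans hu, (Nat.le_ceil _).trans he⟩

/-- **`8·WN ≤ X`** (as `G = 8(n+1)`): the range dominates the per-derivative unit. [folklore] -/
theorem eight_WN_le_X : 8 * P.WN ≤ P.X := by
  have h := P.X_floors.2.2.1
  rw [G_eq, div_le_iff₀ (by positivity)] at h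
  have hn : (0 : ℝ) ≤ n := Nat.cast_nonneg n
  nlinarith [P.WN_bounds.2.2.2]

end ArchG3Rec

end Summit.ABC.StewartYu
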